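import Summits.BirchSwinnertonDyer.Rank1Residual.AdditivePotMult.QuadraticBaseChangeOddTamagawaDictionary
import HarnessLib

/-!
# The local odd-Tamagawa identities (T) of a quadratic base change, place by place
# (row T-MIL-ODD, FILE C-3b; seat n1011-p01 GEN 6)

HONEST FRAMING (cell `b2b-bsdres`, run/shared/lean/b2b/bsd-rank1-residual/, verbatim in every
file): the goal of the cell is to DELETE the COMBINATION-SHAPED residual classes of the
Birch–Swinnerton-Dyer formula for ALL analytic-rank `≤ 1` elliptic curves over `ℚ` — "full BSD
formula for every rank `≤ 1` curve in class `C`" assembled STRICTLY from published theorems — so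
that the rank-`≤ 1` remainder becomes exactly the CONSTRUCTION-SHAPED classes, which are TYPED
(missing-input `Prop`s), NOT attempted. This is not "finishing BSD". Sub-classes X3♯(M) / X4(M)
(additive, potentially multiplicative prime; base-change-and-descend): a RESEARCH ROUTE; they stay
CONSTRUCTION-SHAPED; nothing is booked by this file; no mark / label moved. THEOREMS ONLY: no
definition, no named fact, no `sorry`.

## What and why (row T-MIL-ODD, `cells/n1011/skel/T-MIL-ODD.md` §1 and §6)

The assembly schema (FILE C-2, `padicValRat_norm_mul_tamagawaProduct_eq_of_local[_baseChange]`)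
reduces the odd Tamagawa identity (ODD-TAM)@p of Milne's quadratic BSD quotient to one local
identity per finite place `v` of `ℚ`,

  (T)  `Σ_{w ∣ v} v_p(c_w(W_K)) = v_p(c_v(W)) + v_p(c_v(W_d))`   (`W_d` a model of `W^{(d_K)}`),

plus `δ`-terms at `v = p`. This file DISCHARGES (T), for `W/ℚ` globally minimal, `K` quadratic
(`[K:ℚ] = 2`), `p` odd, at every place `v` of one of the following kinds — the K-side read on
`W_K ⊗ K_w`, the twist side transported to any model `W_d = C_d • W^{(d)}`
(`localTamagawaNumber_eq_of_variableChange_eq`):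

* §2 `v` SPLIT in `K` (two places `w₁ ≠ w₂`, `e = f = 1`), ANY reduction type of `W`:
  `c_{w_i}(W_K) = c_v(W)` (x11b `localTamagawaNumber_baseChange_eq_of_degree_one`) and
  `c_v(W_d) = c_v(W)` (`d_K ∈ ℚ_ℓ^{×2}`, x11b `isSquare_padic_discr_of_splitsIn`,
  `localTamagawaNumber_eq_of_twist_of_isSquare`) — `sum_fibre_padicValNat_localTamagawaNumber_of_split`
  (this is x11b/multr1-p1's split case of `X11b/TamagawaQuadraticPlaces.padicValNat_sum_fibre_eq`,
  re-derived from their lemmas BY NAME because their theorem carries global `p ≥ 5`/`hbad` binders);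
* §3 `W` GOOD at `v`: every `c = 1` on the `K`-side (stage A-3
  `localTamagawaNumber_baseChange_eq_one_of_good`), `c_v(W) = 1`, and `v_p(c_v(W_d)) = 0` at an odd
  `v` with `ℓ² ∤ d` (unit twist good, A-3; ramified twist `I₀*`, A-odd);
* §4–§5 `W` MULTIPLICATIVE at `v` (`n = ord_v Δ_min`): above an INERT place (`e = 1`, `f = 2`; `ℓ`
  odd) `c_w(W_K) = n` (A-1b, `f` even ⇒ split) against `v_p(c_v(W)) + v_p(c_v(W^{(d)})) = v_p(n)`
  (A-2a: `d_K` is a NON-square mod `ℓ` at an inert `ℓ ∤ d_K` — the decomposition law, tree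
  `KroneckerSplitting.ncard_primesOver_eq_two_iff_legendreSym`, and Dedekind's discriminant theorem
  for `ℓ ∤ d_K`, §0); above a RAMIFIED place (`e = 2`, `f = 1`; `ℓ ∥ d`)
  `v_p(c_w(W_K)) = [split]·v_p(2n) = v_p(c_v(W))` (A-1a/A-1b) and `v_p(c_v(W^{(d)})) = 0` (A-odd);
* §5 the POTENTIALLY MULTIPLICATIVE ramified place of X3♯(M)/X4(M) (`W_d` multiplicative at `v`,
  `W` additive): `c_w(W_K) = c_w(W_{d,K})` (A-4K), then the ramified computation for `W_d`, against
  `v_p(c_v(W)) = 0` (A-odd) — `sum_fibre_padicValNat_localTamagawaNumber_of_potMult_of_ramified`.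

The field-theoretic dictionary (inert / split / ramified ⇔ the arithmetic of `d_K` at `ℓ`) and
the model transport are FILE C-3a (`QuadraticBaseChangeOddTamagawaDictionary`). In print: Kramer, Trans. AMS 264 (1981) §2 Props. 1–3 (the
local norm indices place by place); Silverman *ATAEC* IV.9.4 and Table 4.1; Neukirch Ch. I (8.2),
III (2.12). HONEST LIMITS: TOOL theorems; the places NOT treated here are `ℓ = 2` non-split (unit
twists `d ≡ 1 mod 4` via `twistModel`, row A-tail), additive places of `W` unramified in `K`
(A-tail), and the IV/IV* flip at `p = 3` (row T-MIL-B); the `δ`-terms and the assembled END are FILE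
C-3c; closes no class; discharges no fact by itself.
-/

noncomputable section

open scoped Classical NumberField

open WeierstrassCurve NumberField IsDedekindDomain Rat.HeightOneSpectrum WithZero
  Literature.NumberTheory.EllipticCurves
  Summit.BirchSwinnertonDyer.Rank1Residual.Additive

namespace Summit.BirchSwinnertonDyer.Rank1Residual.AdditivePotMult

/-! ## §2 (T) at a SPLIT place (any reduction type) -/

section Split

variable (W : WeierstrassCurve ℚ) [W.IsElliptic] {K : Type} [Field K] [NumberField K]
  (Wd : WeierstrassCurve ℚ) [Wd.IsElliptic] (p : ℕ) (v : HeightOneSpectrum (𝓞 ℚ))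

/-- **(T) at a SPLIT place, any reduction type.** For `W/ℚ` elliptic, `[K:ℚ] = 2`,
`W_d = C_d • W^{(d_K)}`, a prime `p` and a place `v` of `ℚ` with two places `w₁ ≠ w₂` above it
(`e = f = 1`): `Σ_{w ∣ v} v_p(c_w(W_K)) = v_p(c_v(W)) + v_p(c_v(W_d))` — both `c_{w_i}(W_K) = c_v(W)`
(x11b `localTamagawaNumber_baseChange_eq_of_degree_one`) and `c_v(W_d) = c_v(W)` (`d_K` is a square
in `ℚ_ℓ`, x11b `isSquare_padic_discr_of_splitsIn`, `localTamagawaNumber_eq_of_twist_of_isSquare`).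
x11b's split case of `padicValNat_sum_fibre_eq`, freed of its global binders. In print: Kramer 1981
§2 (split primes contribute trivially to the norm index); CGLS 2022 (5.6).
[cite: SilvermanAEC2009, VII.6 (Ex. 7.6) and X.5 Cor. 5.4] -/
theorem sum_fibre_padicValNat_localTamagawaNumber_of_split (h2 : Module.finrank ℚ K = 2)
    {Cd : VariableChange ℚ} (hWd : Cd • W.quadraticTwist (NumberField.discr K : ℚ) = Wd)
    {w₁ w₂ : HeightOneSpectrum (𝓞 K)} (hne : w₁ ≠ w₂)
    (hset : {w : HeightOneSpectrum (𝓞 K) | w.under (𝓞 ℚ) = v} = {w₁, w₂})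
    (hef : ∀ w : HeightOneSpectrum (𝓞 K), w.under (𝓞 ℚ) = v →
      w.asIdeal.ramificationIdx (𝓞 ℚ) = 1 ∧ w.asIdeal.inertiaDeg (𝓞 ℚ) = 1) :
    ∑ w ∈ (HeightOneSpectrum.finite_setOf_under_eq_of_numberField (K := K) v).toFinset,
        padicValNat p (((W.baseChange K).baseChange (w.adicCompletion K)).localTamagawaNumber
          (w.adicCompletionIntegers K)) =
      padicValNat p ((W.baseChange (v.adicCompletion ℚ)).localTamagawaNumber
          (v.adicCompletionIntegers ℚ)) +
        padicValNat p ((Wd.baseChange (v.adicCompletion ℚ)).localTamagawaNumber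
          (v.adicCompletionIntegers ℚ)) := by
  set ℓ : ℕ := (primesEquiv v : ℕ) with hℓdef
  haveI hℓ : Fact ℓ.Prime := ⟨(primesEquiv v).2⟩
  have hvℓ : (primesEquiv v : ℕ) = ℓ := rfl
  have hd : (NumberField.discr K : ℚ) ≠ 0 := by exact_mod_cast NumberField.discr_ne_zero K
  have hfin := HeightOneSpectrum.finite_setOf_under_eq_of_numberField (K := K) v
  have hw₁ : w₁.under (𝓞 ℚ) = v := by
    have h : w₁ ∈ ({w₁, w₂} : Set (HeightOneSpectrum (𝓞 K))) := Set.mem_insert _ _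
    rwa [← hset] at h
  have hw₂ : w₂.under (𝓞 ℚ) = v := by
    have h : w₂ ∈ ({w₁, w₂} : Set (HeightOneSpectrum (𝓞 K))) :=
      Set.mem_insert_of_mem _ (Set.mem_singleton _)
    rwa [← hset] at h
  obtain ⟨he₁, hf₁⟩ := hef w₁ hw₁
  obtain ⟨he₂, hf₂⟩ := hef w₂ hw₂
  have hF : hfin.toFinset = {w₁, w₂} := by
    ext w
    rw [Set.Finite.mem_toFinset, hset]
    simp
  have hs : X11b.SplitsIn K ℓ := by
    show ((Ideal.span {(ℓ : ℤ)}).primesOver (𝓞 K)).ncard = 2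
    rw [hℓdef, X11b.ncard_primesOver_span_eq K v, hset, Set.ncard_pair hne]
  have hsq := X11b.isSquare_padic_discr_of_splitsIn h2 hs
  have c₁ := X11b.localTamagawaNumber_baseChange_eq_of_degree_one W w₁ he₁ hf₁
  have c₂ := X11b.localTamagawaNumber_baseChange_eq_of_degree_one W w₂ he₂ hf₂
  rw [hw₁] at c₁
  rw [hw₂] at c₂
  rw [hF, Finset.sum_pair hne, c₁, c₂,
    X11b.localTamagawaNumber_eq_of_twist_of_isSquare W v hvℓ hd hsq Wd hWd]

end Split

/-! ## §3 (T) at a GOOD place of `W` -/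

section Good

variable (W : WeierstrassCurve ℚ) [W.IsElliptic] [W.IsGloballyMinimal] {K : Type} [Field K]
  [NumberField K] (Wd : WeierstrassCurve ℚ) (p : ℕ) (v : HeightOneSpectrum (𝓞 ℚ))

omit [W.IsElliptic] in
/-- **`K`-side at a GOOD place: `Σ_{w ∣ v} v_p(c_w(W_K)) = 0`** — every `c_w(W_K) = 1` (stage A-3
`localTamagawaNumber_baseChange_eq_one_of_good`). [cite: SilvermanATAEC1994, Cor. IV.9.2(d)] -/
theorem sum_fibre_padicValNat_localTamagawaNumber_eq_zero_of_good (hgood : W.HasGoodReductionAt v) :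
    ∑ w ∈ (HeightOneSpectrum.finite_setOf_under_eq_of_numberField (K := K) v).toFinset,
        padicValNat p (((W.baseChange K).baseChange (w.adicCompletion K)).localTamagawaNumber
          (w.adicCompletionIntegers K)) = 0 := by
  refine Finset.sum_eq_zero fun w hw => ?_
  rw [Set.Finite.mem_toFinset, Set.mem_setOf_eq] at hw
  have h𝔭 : w.asIdeal.under (𝓞 ℚ) = v.asIdeal := by rw [← hw]; rfl
  rw [localTamagawaNumber_baseChange_eq_one_of_good W w hgood h𝔭, padicValNat_one_right]

omit [W.IsElliptic] [W.IsGloballyMinimal] in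
/-- `v_p(c_v(W)) = 0` at a good place (`c_v = 1`, tree
`localTamagawaNumber_eq_one_of_hasGoodReductionAt_holds`). [cite: SilvermanATAEC1994, Cor. IV.9.2(d)] -/
theorem padicValNat_localTamagawaNumber_eq_zero_of_good (hgood : W.HasGoodReductionAt v) :
    padicValNat p ((W.baseChange (v.adicCompletion ℚ)).localTamagawaNumber
        (v.adicCompletionIntegers ℚ)) = 0 := by
  rw [localTamagawaNumber_eq_one_of_hasGoodReductionAt_holds (W := W) v hgood, padicValNat_one_right]

/-- **`v_p(c_v(W_d)) = 0` at a good ODD place** (`ℓ ≠ 2`, `ℓ² ∤ d`, `p` odd, any model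
`W_d = C_d • W^{(d)}`): if `ℓ ∤ d` the twist is good (`c = 1`, A-3
`localTamagawaNumber_quadraticTwist_eq_one_of_not_dvd`); if `ℓ ∥ d` it is of type `I₀*` with
`c ∈ {1, 2, 4}` (A-odd `…_of_dvd_of_good_of_odd`). [cite: SilvermanATAEC1994, IV.9.4 Step 6 and Table 4.1] -/
theorem padicValNat_localTamagawaNumber_twist_eq_zero_of_good_of_odd
    (hv2 : (primesEquiv v : ℕ) ≠ 2) {d : ℤ} (hd0 : d ≠ 0)
    (hd2 : ¬ ((primesEquiv v : ℕ) : ℤ) ^ 2 ∣ d) {Cd : VariableChange ℚ}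
    (hWd : Cd • W.quadraticTwist (d : ℚ) = Wd) (hgood : W.HasGoodReductionAt v) [Fact p.Prime]
    (hp2 : p ≠ 2) :
    padicValNat p ((Wd.baseChange (v.adicCompletion ℚ)).localTamagawaNumber
        (v.adicCompletionIntegers ℚ)) = 0 := by
  have hdq : (d : ℚ) ≠ 0 := by exact_mod_cast hd0
  haveI := W.isElliptic_quadraticTwist hdq
  rw [localTamagawaNumber_eq_of_variableChange_eq hWd v]
  by_cases hd1 : ((primesEquiv v : ℕ) : ℤ) ∣ d
  · exact padicValNat_localTamagawaNumber_quadraticTwist_eq_zero_of_dvd_of_good_of_odd W v hv2 hd1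
      hd2 hgood p hp2
  · rw [localTamagawaNumber_quadraticTwist_eq_one_of_not_dvd W v hv2 hd1 hgood,
      padicValNat_one_right]

end Good

/-! ## §4 (T) at a MULTIPLICATIVE place of `W`: the `K`-side above an inert / a ramified place -/

section Mult

variable (V : WeierstrassCurve ℚ) [V.IsElliptic] [V.IsGloballyMinimal] {K : Type} [Field K]
  [NumberField K] (p : ℕ) [hp : Fact p.Prime] {v : HeightOneSpectrum (𝓞 ℚ)}
  {w : HeightOneSpectrum (𝓞 K)}

omit hp in
/-- `e(w|v)`: the primed ramification index of the stage-A files (`v.asIdeal.ramificationIdx' w.asIdeal`)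
is the trichotomy's `w.asIdeal.ramificationIdx (𝓞 ℚ)` (Mathlib `ramificationIdx'_eq_ramificationIdx`).
[folklore] -/
theorem ramificationIdx'_eq_of_under_eq (hw : w.under (𝓞 ℚ) = v) :
    v.asIdeal.ramificationIdx' w.asIdeal = w.asIdeal.ramificationIdx (𝓞 ℚ) := by
  haveI : w.asIdeal.LiesOver v.asIdeal := ⟨by rw [← hw]; rfl⟩
  exact Ideal.ramificationIdx'_eq_ramificationIdx v.asIdeal w.asIdeal v.ne_bot

omit hp in
/-- `N(w) = ℓ_v^{f(w|v)}` for `w ∣ v` (FILE C-1 `absNorm_asIdeal_eq_primesEquiv_pow`): the `hN` input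
of the stage-A parity lemmas. [cite: NeukirchANT1999, Ch. I, Prop. (8.2)] -/
theorem absNorm_eq_pow_of_under_eq (hw : w.under (𝓞 ℚ) = v) :
    Ideal.absNorm w.asIdeal = (primesEquiv v : ℕ) ^ w.asIdeal.inertiaDeg (𝓞 ℚ) := by
  rw [absNorm_asIdeal_eq_primesEquiv_pow w, hw]

omit hp in
/-- **`K`-side above an INERT place of a multiplicative `V`: `v_p(c_w(V_K)) = v_p(n)`** (`e = 1`,
`f = 2`: `V_K` is split at `w` whatever `V` is at `v`, `c_w = e·n = n`; stage A-1b
`localTamagawaNumber_baseChange_eq_mul_of_mult_of_even`). Kramer 1981 Prop. 2 (unramified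
quadratic base change of a Tate curve). [cite: SilvermanATAEC1994, IV.9.4 Step 2 and Cor. IV.9.2(d)] -/
theorem padicValNat_localTamagawaNumber_baseChange_of_mult_of_inert
    (hmult : V.HasMultiplicativeReductionAt v) (hw : w.under (𝓞 ℚ) = v)
    (he : w.asIdeal.ramificationIdx (𝓞 ℚ) = 1) (hf : w.asIdeal.inertiaDeg (𝓞 ℚ) = 2) :
    padicValNat p (((V.baseChange K).baseChange (w.adicCompletion K)).localTamagawaNumber
        (w.adicCompletionIntegers K)) = padicValNat p (V.ordMinimalDiscriminant v) := by
  have h𝔭 : w.asIdeal.under (𝓞 ℚ) = v.asIdeal := by rw [← hw]; rfl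
  have hN := absNorm_eq_pow_of_under_eq (K := K) hw
  rw [hf] at hN
  rw [localTamagawaNumber_baseChange_eq_mul_of_mult_of_even V w hmult h𝔭 hN even_two,
    ramificationIdx'_eq_of_under_eq hw, he, one_mul]

/-- **`K`-side above a RAMIFIED place of a multiplicative `V`, `p` odd:
`v_p(c_w(V_K)) = v_p(c_v(V))`** (`e = 2`, `f = 1`: `V_K` is split at `w` iff `V` is split at `v`,
A-1a `hasSplitMultiplicativeReductionAt_baseChange_iff_of_mult_of_odd` with `f = 1`; then
`c_w = 2n` vs `c_v = n` — `v_p(2) = 0` — or both `∈ {1, 2}`; A-1b, A-2a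
`padicValNat_localTamagawaNumber_of_hasMultiplicativeReductionAt`). Kramer 1981 Prop. 1.
[cite: SilvermanATAEC1994, IV.9.4 Step 2 and Cor. IV.9.2(d)] -/
theorem padicValNat_localTamagawaNumber_baseChange_of_mult_of_ramified
    (hmult : V.HasMultiplicativeReductionAt v)
    (hw : w.under (𝓞 ℚ) = v) (he : w.asIdeal.ramificationIdx (𝓞 ℚ) = 2)
    (hf : w.asIdeal.inertiaDeg (𝓞 ℚ) = 1) (hp2 : p ≠ 2) :
    padicValNat p (((V.baseChange K).baseChange (w.adicCompletion K)).localTamagawaNumber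
        (w.adicCompletionIntegers K)) =
      padicValNat p ((V.baseChange (v.adicCompletion ℚ)).localTamagawaNumber
        (v.adicCompletionIntegers ℚ)) := by
  haveI : Fact (primesEquiv v : ℕ).Prime := ⟨(primesEquiv v).2⟩
  have h𝔭 : w.asIdeal.under (𝓞 ℚ) = v.asIdeal := by rw [← hw]; rfl
  have hN := absNorm_eq_pow_of_under_eq (K := K) hw
  rw [hf] at hN
  have hmultP : V.HasMultiplicativeReductionAtPrime (primesEquiv v : ℕ) :=
    (hasMultiplicativeReductionAtPrime_iff_hasMultiplicativeReductionAt_ringOfIntegers V v).mpr hmult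
  have hiff : (V.baseChange K).HasSplitMultiplicativeReductionAt w ↔
      V.HasSplitMultiplicativeReductionAt v := by
    rw [hasSplitMultiplicativeReductionAt_baseChange_iff_of_mult_of_odd V (primesEquiv v : ℕ) w
      (natCast_primesEquiv_mem_of_under_eq w h𝔭) hmultP hN odd_one,
      hasSplitMultiplicativeReductionAtPrime_iff_hasSplitMultiplicativeReductionAt V v]
  rw [padicValNat_localTamagawaNumber_of_hasMultiplicativeReductionAt v V p hp2 hmult]
  split_ifs with hs
  · have hn0 : V.ordMinimalDiscriminant v ≠ 0 :=
      (X11b.ordMinimalDiscriminant_pos_of_hasMultiplicativeReductionAt v V hmult).ne'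
    haveI : Fact (Nat.Prime 2) := ⟨Nat.prime_two⟩
    rw [padicValNat_localTamagawaNumber_baseChange_of_split V w p hmult h𝔭 (hiff.mpr hs),
      ramificationIdx'_eq_of_under_eq hw, he, padicValNat.mul two_ne_zero hn0,
      padicValNat_primes hp2, zero_add]
  · exact padicValNat_localTamagawaNumber_baseChange_eq_zero_of_not_split V w p hp2 hmult h𝔭
      (fun h => hs (hiff.mp h))

end Mult

/-! ## §5 (T) at a multiplicative place: inert, ramified, and the potentially multiplicative
ramified place -/

section MultIdentities

variable (W : WeierstrassCurve ℚ) [W.IsElliptic] [W.IsGloballyMinimal] {K : Type} [Field K]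
  [NumberField K] (Wd : WeierstrassCurve ℚ) (p : ℕ) [hp : Fact p.Prime]
  (v : HeightOneSpectrum (𝓞 ℚ))

/-- **(T) at an INERT odd MULTIPLICATIVE place.** `W/ℚ` globally minimal, multiplicative at
`v ↔ ℓ ≠ 2`, `[K:ℚ] = 2` with a single place `w` above `v`, `e = 1`, `f = 2`, `W_d = C_d • W^{(d_K)}`,
`p` odd: `v_p(c_w(W_K)) = v_p(n) = v_p(c_v(W)) + v_p(c_v(W_d))` — the `K`-side by
`padicValNat_localTamagawaNumber_baseChange_of_mult_of_inert`, the `ℚ`-side by A-2a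
`padicValNat_localTamagawaNumber_add_quadraticTwist_of_not_isSquare` (exactly one of `W`, `W^{(d)}`
is split since `d_K` is a non-square mod `ℓ`, §0). Kramer 1981 Prop. 2. [cite: SilvermanATAEC1994, IV.9.4 Step 2] -/
theorem sum_fibre_padicValNat_localTamagawaNumber_of_mult_of_inert (h2 : Module.finrank ℚ K = 2)
    {Cd : VariableChange ℚ} (hWd : Cd • W.quadraticTwist (NumberField.discr K : ℚ) = Wd)
    (hv2 : (primesEquiv v : ℕ) ≠ 2) (hmult : W.HasMultiplicativeReductionAt v)
    {w : HeightOneSpectrum (𝓞 K)}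
    (hset : {w' : HeightOneSpectrum (𝓞 K) | w'.under (𝓞 ℚ) = v} = {w})
    (he : w.asIdeal.ramificationIdx (𝓞 ℚ) = 1) (hf : w.asIdeal.inertiaDeg (𝓞 ℚ) = 2)
    (hp2 : p ≠ 2) :
    ∑ w ∈ (HeightOneSpectrum.finite_setOf_under_eq_of_numberField (K := K) v).toFinset,
        padicValNat p (((W.baseChange K).baseChange (w.adicCompletion K)).localTamagawaNumber
          (w.adicCompletionIntegers K)) =
      padicValNat p ((W.baseChange (v.adicCompletion ℚ)).localTamagawaNumber
          (v.adicCompletionIntegers ℚ)) +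
        padicValNat p ((Wd.baseChange (v.adicCompletion ℚ)).localTamagawaNumber
          (v.adicCompletionIntegers ℚ)) := by
  have hfin := HeightOneSpectrum.finite_setOf_under_eq_of_numberField (K := K) v
  have hw : w.under (𝓞 ℚ) = v := by
    have h : w ∈ ({w} : Set (HeightOneSpectrum (𝓞 K))) := Set.mem_singleton _
    rwa [← hset] at h
  have hF : hfin.toFinset = {w} := by
    ext w'
    rw [Set.Finite.mem_toFinset, hset]
    simp
  obtain ⟨hnd, hnsq⟩ := not_dvd_and_not_isSquare_discr_of_inert v h2 hv2 hset he
  have hd : (NumberField.discr K : ℚ) ≠ 0 := by exact_mod_cast NumberField.discr_ne_zero K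
  haveI := W.isElliptic_quadraticTwist hd
  rw [hF, Finset.sum_singleton,
    padicValNat_localTamagawaNumber_baseChange_of_mult_of_inert W p hmult hw he hf,
    localTamagawaNumber_eq_of_variableChange_eq hWd v]
  exact (padicValNat_localTamagawaNumber_add_quadraticTwist_of_not_isSquare W v hv2 hnd hnsq hmult
    p hp2).symm

/-- **(T) at a RAMIFIED odd MULTIPLICATIVE place.** `W/ℚ` globally minimal, multiplicative at
`v ↔ ℓ ≠ 2`, a single place `w` above `v` with `e = 2`, `f = 1`, `ℓ ∥ d`, `W_d = C_d • W^{(d)}`, `p`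
odd: `v_p(c_w(W_K)) = v_p(c_v(W)) + 0` (`padicValNat_localTamagawaNumber_baseChange_of_mult_of_ramified`;
the ramified twist is additive of type `Iₙ*`, `v_p(c_v(W_d)) = 0`, A-odd). Kramer 1981 Prop. 1.
[cite: SilvermanATAEC1994, IV.9.4 Steps 2 and 7, Table 4.1] -/
theorem sum_fibre_padicValNat_localTamagawaNumber_of_mult_of_ramified
    {d : ℤ} (hd2 : ¬ ((primesEquiv v : ℕ) : ℤ) ^ 2 ∣ d)
    {Cd : VariableChange ℚ} (hWd : Cd • W.quadraticTwist (d : ℚ) = Wd)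
    (hv2 : (primesEquiv v : ℕ) ≠ 2) (hmult : W.HasMultiplicativeReductionAt v)
    {w : HeightOneSpectrum (𝓞 K)}
    (hset : {w' : HeightOneSpectrum (𝓞 K) | w'.under (𝓞 ℚ) = v} = {w})
    (he : w.asIdeal.ramificationIdx (𝓞 ℚ) = 2) (hf : w.asIdeal.inertiaDeg (𝓞 ℚ) = 1)
    (hd1 : ((primesEquiv v : ℕ) : ℤ) ∣ d) (hp2 : p ≠ 2) :
    ∑ w ∈ (HeightOneSpectrum.finite_setOf_under_eq_of_numberField (K := K) v).toFinset,
        padicValNat p (((W.baseChange K).baseChange (w.adicCompletion K)).localTamagawaNumber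
          (w.adicCompletionIntegers K)) =
      padicValNat p ((W.baseChange (v.adicCompletion ℚ)).localTamagawaNumber
          (v.adicCompletionIntegers ℚ)) +
        padicValNat p ((Wd.baseChange (v.adicCompletion ℚ)).localTamagawaNumber
          (v.adicCompletionIntegers ℚ)) := by
  have hfin := HeightOneSpectrum.finite_setOf_under_eq_of_numberField (K := K) v
  have hw : w.under (𝓞 ℚ) = v := by
    have h : w ∈ ({w} : Set (HeightOneSpectrum (𝓞 K))) := Set.mem_singleton _
    rwa [← hset] at h
  have hF : hfin.toFinset = {w} := by
    ext w'
    rw [Set.Finite.mem_toFinset, hset]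
    simp
  have hd0 : d ≠ 0 := by rintro rfl; exact hd2 (dvd_zero _)
  have hdq : (d : ℚ) ≠ 0 := by exact_mod_cast hd0
  haveI := W.isElliptic_quadraticTwist hdq
  rw [hF, Finset.sum_singleton,
    padicValNat_localTamagawaNumber_baseChange_of_mult_of_ramified W p hmult hw he hf hp2,
    localTamagawaNumber_eq_of_variableChange_eq hWd v,
    padicValNat_localTamagawaNumber_quadraticTwist_eq_zero_of_dvd_of_mult_of_odd W v hv2 hd1 hd2
      hmult p hp2, add_zero]

variable [Wd.IsElliptic] [Wd.IsGloballyMinimal]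

omit [W.IsGloballyMinimal] in
/-- **(T) at the POTENTIALLY MULTIPLICATIVE ramified place of X3♯(M)/X4(M).** `W/ℚ`, `[K:ℚ] = 2`,
`W_d = C_d • W^{(d_K)}` GLOBALLY MINIMAL and MULTIPLICATIVE at `v ↔ ℓ ≠ 2` (so `W` is additive,
potentially multiplicative at `v`), a single place `w` above `v` with `e = 2`, `f = 1`, `ℓ ∥ d_K`, `p`
odd: `v_p(c_w(W_K)) = 0 + v_p(c_v(W_d))` — `W_K ≅ W_{d,K}` (`√d_K ∈ K`, A-4K
`localTamagawaNumber_baseChange_eq_of_twist`), the ramified computation for `W_d`, and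
`v_p(c_v(W)) = 0` (`W = C • W_d^{(d)}` is the ramified twist of a multiplicative curve, type `Iₙ*`,
A-odd `padicValNat_localTamagawaNumber_eq_zero_of_mult_twist_of_odd`).
[cite: SilvermanATAEC1994, IV.9.4 Steps 2 and 7, Table 4.1] [cite: SilvermanAEC2009, VII.1 Prop. 1.3(b)] -/
theorem sum_fibre_padicValNat_localTamagawaNumber_of_potMult_of_ramified
    (h2 : Module.finrank ℚ K = 2) (hd2 : ¬ ((primesEquiv v : ℕ) : ℤ) ^ 2 ∣ NumberField.discr K)
    {Cd : VariableChange ℚ} (hWd : Cd • W.quadraticTwist (NumberField.discr K : ℚ) = Wd)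
    (hv2 : (primesEquiv v : ℕ) ≠ 2) (hmult : Wd.HasMultiplicativeReductionAt v)
    {w : HeightOneSpectrum (𝓞 K)}
    (hset : {w' : HeightOneSpectrum (𝓞 K) | w'.under (𝓞 ℚ) = v} = {w})
    (he : w.asIdeal.ramificationIdx (𝓞 ℚ) = 2) (hf : w.asIdeal.inertiaDeg (𝓞 ℚ) = 1)
    (hd1 : ((primesEquiv v : ℕ) : ℤ) ∣ NumberField.discr K) (hp2 : p ≠ 2) :
    ∑ w ∈ (HeightOneSpectrum.finite_setOf_under_eq_of_numberField (K := K) v).toFinset,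
        padicValNat p (((W.baseChange K).baseChange (w.adicCompletion K)).localTamagawaNumber
          (w.adicCompletionIntegers K)) =
      padicValNat p ((W.baseChange (v.adicCompletion ℚ)).localTamagawaNumber
          (v.adicCompletionIntegers ℚ)) +
        padicValNat p ((Wd.baseChange (v.adicCompletion ℚ)).localTamagawaNumber
          (v.adicCompletionIntegers ℚ)) := by
  have hfin := HeightOneSpectrum.finite_setOf_under_eq_of_numberField (K := K) v
  have hw : w.under (𝓞 ℚ) = v := by
    have h : w ∈ ({w} : Set (HeightOneSpectrum (𝓞 K))) := Set.mem_singleton _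
    rwa [← hset] at h
  have hF : hfin.toFinset = {w} := by
    ext w'
    rw [Set.Finite.mem_toFinset, hset]
    simp
  obtain ⟨θ, hθ0, hθ⟩ := exists_sq_eq_discr h2
  rw [hF, Finset.sum_singleton,
    ← localTamagawaNumber_baseChange_eq_of_twist W Wd w hWd hθ0 hθ,
    padicValNat_localTamagawaNumber_baseChange_of_mult_of_ramified Wd p hmult hw he hf hp2,
    padicValNat_localTamagawaNumber_eq_zero_of_mult_twist_of_odd W Wd v hv2 hd1 hd2 hWd hmult p hp2,
    zero_add]

end MultIdentities

end Summit.BirchSwinnertonDyer.Rank1Residual.AdditivePotMult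

end
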